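import Summits.QuantumFields.BalabanUV.Beta.ReflectionLocusCombShift
import Summits.QuantumFields.BalabanUV.Beta.ReflectionLocusSymPure

/-!
# `BalabanUV.Beta.ReflectionLocusCombPure` — binder row D1, RULING R-D1-g35-1 (chart (III′)), brick P6-0b: **(Sr-conj) FOR THE COMB LITERAL's UNFOLDED (PURE)
# FIRST-ORDER TABLES `SpureCombOf tabs Lc⁴ (−Lc⁴·½·Lc⁴) cΛ` AT EVERY LEVEL, SAME CONTACT AS THE FOLDED FAMILY** — `ReflectionLocusSymPure.SpureRecOf_bref_of_SrecOf_bref`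
# (resolvent-generic) fed by `ReflectionLocusCombShift.hSrC_ScombOf_all` (p314410); the (III′) twin of `ReflectionLocusSymPure.SpureSymOf_bref_all_an1Shift`

HONEST FRAMING (cell contract, verbatim): «discharging `BetaPertH` makes Bałaban's UV stability UNCONDITIONAL — a real constructive-QFT
result; it is NOT the continuum limit and NOT the Clay problem.»  HONEST DEPENDENCY: continuum YM on T⁴ ⇐ BetaPertH ∧ nine spine estimates (0/9 proved);
BetaPertH ⇐ (D1) ∧ (D4) ∧ CAP+tail; G-an2-4 gates asym, D1 and NE2/3/4.
DERIVED cell leaf ([folklore] wiring BY NAME; β sub-cell, BINDER-OWNERS row D1 OWNER `b2b-balaban-beta-an2` gen 36, programme P6).  No statement of Bałaban's papers,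
no `[cite:]`, no `Prop` fact, no `def`.  Displayed: the table letters (V-r) (three border leg pairs, generator `ctGenM 3 (bhK Lc + Dsh Lc)`), (V-ff0), (H-r); every shift
letter is a theorem for `Dsh Lc`.  Discharges NO binder by itself; RECORD = ROOT M′ p303989 (chart (II)) unchanged; NOT D1, NOT `BetaPertH`, NOT continuum, NOT Clay.
Provenance: β sub-cell, unit beta-an2 gen 36, 2026-08-22 (v1); no existing file touched.
-/

noncomputable section

open Finset
open scoped BigOperators
open Literature.MathematicalPhysics.QuantumFieldTheory
open Literature.MathematicalPhysics.QuantumFieldTheory.Balaban1983to89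
open Literature.MathematicalPhysics.QuantumFieldTheory.Balaban1983to89.Beta
open ExpKernelCalculus (MKer comp)
open PolarizationSign (reflSign)
open KernelReflection (refK)
open ResolventReflection (bref Φ)
open OneStepResolventKernel (Fib)
open BalabanStepJetsSucc (wVH)
open Summit.QuantumFields.BalabanUV.Beta.TameKernelCalculus
open Summit.QuantumFields.BalabanUV.Beta.ChartConjugation (conjV)
open Summit.QuantumFields.BalabanUV.Beta.BorderedHessian (bhK stepScale diagK)
open Summit.QuantumFields.BalabanUV.Beta.SymmetrisedStepJets (SymTables)
open Summit.QuantumFields.BalabanUV.Beta.SymShiftedSpread (bhKStepSh)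
open Summit.QuantumFields.BalabanUV.Beta.E3ContactGenerator (ctGenM)
open Summit.QuantumFields.BalabanUV.Beta.DshAn1 (Dsh)
open Summit.QuantumFields.BalabanUV.Beta.CombChartStepJets (GcombSh ScombOf SpureCombOf ScombOf_eq SpureCombOf_eq)
open Summit.QuantumFields.BalabanUV.Beta.ReflectionLocusCombShift (hSrC_ScombOf_all)
open Summit.QuantumFields.BalabanUV.Beta.ReflectionLocusSymPure (SpureRecOf_bref_of_SrecOf_bref)

namespace Summit.QuantumFields.BalabanUV.Beta.ReflectionLocusCombPure

variable {Lc : ℕ} [NeZero Lc]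

/-- [folklore] **(Sr-conj) FOR `SpureCombOf tabs` AT an1's TYPED SHIFT `Dsh Lc`, EVERY LEVEL** (displayed: (V-r)×3, (V-ff0), (H-r); contact coefficient
`(−Lc⁴·½·Lc⁴)·wVH j ∕ (stepScale j·Lc⁴)` against `bhKStepSh 3 Lc (Dsh Lc) j`). -/
theorem SpureCombOf_bref_all (hLc : Odd Lc) (tabs : SymTables 3 Lc) (cΛ : ℝ) {α : Fin 4}
    (hVfm : ∀ (κ' : Fin 4) (u x z : Fin 4 → ℤ) (β μ : Fin 4), tabs.V κ' (bref α κ' u) x z (Sum.inl β) (Sum.inr μ) =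
      (reflSign α κ' • refK (Φ (d := 3) Lc α) (tabs.V κ' u + conjV (bhK (d := 3) Lc + Dsh Lc)
        ((((Lc : ℝ) ^ 4)⁻¹) • diagK (ctGenM 3 (bhK Lc + Dsh Lc) α Lc κ' u)))) x z (Sum.inl β) (Sum.inr μ))
    (hVmf : ∀ (κ' : Fin 4) (u x z : Fin 4 → ℤ) (μ β : Fin 4), tabs.V κ' (bref α κ' u) x z (Sum.inr μ) (Sum.inl β) =
      (reflSign α κ' • refK (Φ (d := 3) Lc α) (tabs.V κ' u + conjV (bhK (d := 3) Lc + Dsh Lc)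
        ((((Lc : ℝ) ^ 4)⁻¹) • diagK (ctGenM 3 (bhK Lc + Dsh Lc) α Lc κ' u)))) x z (Sum.inr μ) (Sum.inl β))
    (hVmm : ∀ (κ' : Fin 4) (u x z : Fin 4 → ℤ) (μ μ' : Fin 4), tabs.V κ' (bref α κ' u) x z (Sum.inr μ) (Sum.inr μ') =
      (reflSign α κ' • refK (Φ (d := 3) Lc α) (tabs.V κ' u + conjV (bhK (d := 3) Lc + Dsh Lc)
        ((((Lc : ℝ) ^ 4)⁻¹) • diagK (ctGenM 3 (bhK Lc + Dsh Lc) α Lc κ' u)))) x z (Sum.inr μ) (Sum.inr μ'))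
    (hV0 : ∀ (κ : Fin 4) (w x z : Fin 4 → ℤ) (β β' : Fin 4), tabs.V κ w x z (Sum.inl β) (Sum.inl β') = 0)
    (hHr : ∀ (α' μ : Fin 4) (y : Fin 4 → ℤ), tabs.H μ (bref α' μ y) = reflSign α' μ • refK (Φ (d := 3) Lc α') (tabs.H μ y)) :
    ∀ (j : ℕ) (κ : Fin 4) (u : Fin 4 → ℤ),
      SpureCombOf tabs ((Lc : ℝ) ^ 4) (-((Lc : ℝ) ^ 4 * (1 / 2) * (Lc : ℝ) ^ 4)) cΛ j κ (bref α κ u) =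
        reflSign α κ • refK (Φ Lc α) (SpureCombOf tabs ((Lc : ℝ) ^ 4) (-((Lc : ℝ) ^ 4 * (1 / 2) * (Lc : ℝ) ^ 4)) cΛ j κ u +
          conjV (bhKStepSh 3 Lc (Dsh Lc) j) ((-((Lc : ℝ) ^ 4 * (1 / 2) * (Lc : ℝ) ^ 4) * wVH 3 Lc j / (stepScale 3 Lc j * (Lc : ℝ) ^ 4)) •
            diagK (ctGenM 3 (bhK Lc + Dsh Lc) α Lc κ u))) := by
  have hS := hSrC_ScombOf_all hLc tabs cΛ hVfm hVmf hVmm hV0 hHr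
  rw [ScombOf_eq] at hS
  rw [SpureCombOf_eq]
  exact SpureRecOf_bref_of_SrecOf_bref (d := 3) hHr hS

end Summit.QuantumFields.BalabanUV.Beta.ReflectionLocusCombPure

end
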